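import Summits.QuantumAdvantage.QuantumAdvantage.Theorems.CharDialStrataDialB
import HarnessLib

/-!
# CharDialStrataDialC — tree twin (part C) of the decomp-qadv lens-5 g31 node «StrataDial» on `CharDial.FrobStructureLawOdd`

§5 the collapse, BY NAME against the tree: `exchCoreAt_iff_tabAt : IslandDial.ExchCoreAt p ↔ TableDial.TabAt p`,
`exchCoreAt_seven_of_core : TabLaw 7 4 9 → ExchCoreAt 7`, `exchCoreAt_five_of_core`, `lawAt_of_core_island`,
`closes : TabOdd → IslandOdd → CharDial.FrobStructureLawOdd`, `target_iff : FrobStructureLawOdd ↔ TabOdd ∧ IslandOdd`,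
`pieces_of_tab : TabOdd → SeedOdd ∧ TabOdd ∧ GlueOdd`.  Parts A/B: `CharDialStrataDialA/B`.  No `sorry`, no defs.
-/

set_option autoImplicit false
set_option linter.dupNamespace false

namespace Summit.QuantumAdvantage.QuantumAdvantage.Theorems.StrataDial

open Finset
open Summit.QuantumAdvantage.AdviceFreeQNC0
open Literature.Computability.MetaComplexity Literature.Computability.MetaComplexity.Smolensky
open Summit.QuantumAdvantage.QuantumAdvantage.Theorems.IslandDial (Exch TopConst ExchCoreAt ExchCoreOdd IslandAt IslandOdd
  NormalForm lawAt_of_pieces)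
open Summit.QuantumAdvantage.QuantumAdvantage.Theorems.LevelDial (RPrimeAt nB BaseAt BaseOdd TailAt GlueAt GlueOdd
  depOn_slice hasDegF_slice topConst_slice exch_mono)
open Summit.QuantumAdvantage.QuantumAdvantage.Theorems.TableDial (TabLaw TabAt TabOdd SeedLevel SeedAt SeedOdd FewAt FewOdd
  tabLaw_all_of_core tabAt_iff_all exchCoreAt_of_seed_tab_glue tabAt_of_exchCoreAt fewAt_of_exchCoreAt)

/-! ### §5 The collapse: E(p) ⟺ the table core; the target ⟺ TabOdd ∧ IslandOdd -/

section Collapse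

variable {p : ℕ} [hp : Fact p.Prime]

/-- ★★ **PIECE E IS THE TABLE CORE**: `ExchCoreAt p ↔ TabAt p` (g30's `exchCoreAt_iff_pieces` with «Seed» and «Glue» discharged). -/
theorem exchCoreAt_iff_tabAt (p : ℕ) [Fact p.Prime] : ExchCoreAt p ↔ TabAt p :=
  ⟨tabAt_of_exchCoreAt, fun hT => exchCoreAt_of_seed_tab_glue (seedAt_of_tabAt hT) hT (glueAt_holds p)⟩

/-- g29's finite range from the table core alone. -/
theorem baseAt_of_tabAt (hT : TabAt p) : BaseAt p :=
  Summit.QuantumAdvantage.QuantumAdvantage.Theorems.TableDial.baseAt_of_seed_tab (seedAt_of_tabAt hT) hT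

/-- The rung `FewAt p` (boundedly many exchangeability classes) from the table core alone. -/
theorem fewAt_of_tabAt (hT : TabAt p) : FewAt p := fewAt_of_exchCoreAt ((exchCoreAt_iff_tabAt p).2 hT)

/-- **LOCATED RESIDUAL OF E(7) DISCHARGED**: the instrument-certified table core `TabLaw 7 4 9` (census K41 A3, g30 `tabcheck.c`)
now gives `ExchCoreAt 7` outright — g30's remaining «one seed level `m ≥ 14` ∧ GlueAt 7» is a theorem. -/
theorem exchCoreAt_seven_of_core [Fact (Nat.Prime 7)] (hcore : TabLaw 7 4 9) : ExchCoreAt 7 :=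
  (exchCoreAt_iff_tabAt 7).2 ⟨4, hcore⟩

/-- … and `TabLaw 5 1 3` (lens-6 CENSUS-I2, `K₀(5) = 1`) gives `ExchCoreAt 5`. -/
theorem exchCoreAt_five_of_core [Fact (Nat.Prime 5)] (hcore : TabLaw 5 1 3) : ExchCoreAt 5 :=
  (exchCoreAt_iff_tabAt 5).2 ⟨1, hcore⟩

/-- **LAW 2½ AT ONE PRIME from the table core and the island** (tree `IslandDial.lawAt_of_pieces` with piece E discharged to the core):
at `p = 7` the hypotheses are the instrument-certified `TabLaw 7 4 9` and `IslandAt 7`. -/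
theorem lawAt_of_core_island (p : ℕ) [Fact p.Prime] {K : ℕ} (hcore : TabLaw p K (2 * K + 1)) (hI : IslandAt p) :
    ∃ J₀ : ℕ, ∀ (n : ℕ) (f : (Fin n → Bool) → Bool), HasDegF p f (p - 1) → NormalForm p f J₀ :=
  lawAt_of_pieces p ((exchCoreAt_iff_tabAt p).2 ⟨K, hcore⟩) hI

/-- Piece E over the odd primes from «Tab». -/
theorem exchCoreOdd_of_tabOdd (hT : TabOdd) : ExchCoreOdd := fun p _ hp5 => (exchCoreAt_iff_tabAt p).2 (hT p hp5)

/-- «Seed» over the odd primes from «Tab». -/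
theorem seedOdd_of_tabOdd (hT : TabOdd) : SeedOdd := fun p _ hp5 => seedAt_of_tabAt (hT p hp5)

/-- **`closes`** — the node's junction onto the live item BY NAME: `TabOdd → IslandOdd → CharDial.FrobStructureLawOdd`
(stmt-QuantumAdvantage-27205). -/
theorem closes (hT : TabOdd) (hI : IslandOdd) : Summit.QuantumAdvantage.QuantumAdvantage.Theses.CharDial.FrobStructureLawOdd :=
  Summit.QuantumAdvantage.QuantumAdvantage.Theorems.IslandDial.closes (exchCoreOdd_of_tabOdd hT) hI

/-- ★★★ **EXACT TWO-PIECE SPLIT**: `FrobStructureLawOdd ↔ TabOdd ∧ IslandOdd`. -/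
theorem target_iff :
    Summit.QuantumAdvantage.QuantumAdvantage.Theses.CharDial.FrobStructureLawOdd ↔ (TabOdd ∧ IslandOdd) :=
  ⟨fun h => ⟨Summit.QuantumAdvantage.QuantumAdvantage.Theorems.TableDial.tabOdd_of_target h,
      Summit.QuantumAdvantage.QuantumAdvantage.Theorems.IslandDial.islandOdd_of_target h⟩,
    fun h => closes h.1 h.2⟩

/-- The g30 four-piece split collapses: its pieces «Seed» and «Glue» follow from «Tab». -/
theorem pieces_of_tab (hT : TabOdd) : SeedOdd ∧ TabOdd ∧ GlueOdd := ⟨seedOdd_of_tabOdd hT, hT, glueOdd_holds⟩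

end Collapse

end Summit.QuantumAdvantage.QuantumAdvantage.Theorems.StrataDial
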